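import Mathlib
import Summits.HodgeConjecture.HodgeConjecture.Theorems.HodgeLocusCensusModelJumpFamily

/-!
# Hodge-locus census — THE K-GEN WITNESS `F′_d = F_{d;1,2} + a b x₁x₂^{d-3}` OF THE CELLS `(4,d,1)`, `d ≥ 6`, for all `d`
(def-free, computable helper of `stmt-HodgeConjecture-16267`; pub-hlocus, seat ivhs-2 = ENGINE B, gen 31; record
`pub-hlocus-ivhs-2/ENGINEB-g31.md` §11 (COROLLARY K-GEN) and §12e; companion of `HodgeLocusCensusModelJumpFamily.lean`, whose
`basis`, `suppMul`, `suppMul_basis` it reuses.)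

COROLLARY K-GEN of the record needs, in every cell, ONE member whose plane algebra `B` is a complete intersection with
`ρ = H_min` (then `ρ = H_min` — hence the closed-form generic row `g = 2a - max(H_B(d), H_B(t-d))`, `b = (H_B(t-d) - H_B(d))⁺` — holds
for the generic smooth member, smooth members existing in every cell by the lead's PROPOSITION S).  In every cell except `(4,d,1)`,
`d ≥ 6` the model member is such a witness (THEOREM K-MODEL); in `(4,d,1)`, `d ≥ 6` the model member has `ρ = 2 < 3 = H_min`
(companion file) and the record's witness is `F′_d := F_{d;1,2} + a b x₁ x₂^{d-3}`: same planes, same `B = K[x₁,x₂]/(x₁^{d-1}, x₂^{d-1})`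
(the added term has no `y`-variable), and restricted transition determinant `δ′ = x₁^{d-2} + x₂^{d-2} + x₁x₂^{d-3}` (all coefficients `1`).

This file kernel-checks, FOR ALL `d ≥ 6`, the column supports of `×δ′ : B_{d-4} → B_{2d-6}` (`suppMulW_basis`): the column of
`x₁^i x₂^{d-4-i}` is `x₁^{d-2}x₂^{d-4}` for `i = 0`, `x₁^{d-4}x₂^{d-2}` for `i = d-5`, `x₁^{d-4}x₂^{d-2} + x₁^{d-3}x₂^{d-3}` for `i = d-4`, and
zero otherwise; the three row monomials and the three column indices are pairwise distinct (`witness_distinct`).  Hence, in the rows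
`(x₁^{d-2}x₂^{d-4}, x₁^{d-3}x₂^{d-3}, x₁^{d-4}x₂^{d-2})` and the columns `(0, d-5, d-4)`, the matrix of `×δ′` is the constant pattern
`!![1,0,0; 0,0,1; 0,1,1]` of determinant `-1` (`pattern_det`), all other columns vanish: `ρ(F′_d) = 3 = H_min` for every `d ≥ 6`
(paper step: a nonzero 3×3 minor in a matrix with 3 rows gives rank 3).  `columnsW_table` re-evaluates the column list by `decide` for
`d = 6..16` (the record's kwitness.md checked `d = 6..16` numerically two ways).

certified instances and evidence bearing on the general Hodge conjecture; no claim.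
-/

set_option maxRecDepth 200000
set_option maxHeartbeats 8000000

namespace Summit.HodgeConjecture.HodgeConjecture.HodgeLocus.Census.ModelJumpWitness

open Summit.HodgeConjecture.HodgeConjecture.HodgeLocus.Census.ModelJumpFamily (basis suppMul suppMul_basis)

/-- support of `x^e · δ′` in `B`, `δ′ = x₁^{d-2} + x₂^{d-2} + x₁x₂^{d-3}` (each listed monomial has coefficient `1`) -/
def suppMulW (d : ℕ) (e : ℕ × ℕ) : List (ℕ × ℕ) :=
  suppMul d e ++ (if e.1 + 1 ≤ d - 2 ∧ e.2 + (d - 3) ≤ d - 2 then [(e.1 + 1, e.2 + (d - 3))] else [])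

/-- the columns of the matrix of `×δ′ : B_{d-4} → B_{2d-6}` in the monomial bases -/
def columnsW (d : ℕ) : List (List (ℕ × ℕ)) := (basis d (d - 4)).map (suppMulW d)

/-- ALL `d ≥ 6`: the column supports of `×δ′` on the basis monomials `x₁^i x₂^{d-4-i}`. -/
theorem suppMulW_basis (d i : ℕ) (hd : 6 ≤ d) (hi : i ≤ d - 4) :
    suppMulW d (i, d - 4 - i) =
      ((if i = 0 then [(d - 2, d - 4)] else []) ++ (if i = d - 4 then [(d - 4, d - 2)] else [])) ++
      ((if i = d - 5 then [(d - 4, d - 2)] else []) ++ (if i = d - 4 then [(d - 3, d - 3)] else [])) := by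
  unfold suppMulW
  rw [suppMul_basis d i (by omega) hi]
  congr 1
  split_ifs <;>
    simp only [List.nil_append, List.append_nil, List.singleton_append, List.cons.injEq, Prod.mk.injEq, and_true,
      List.nil_eq, reduceCtorEq] <;> omega

/-- for `d ≥ 6` the three row monomials are pairwise distinct and so are the three column indices `0, d-5, d-4`. -/
theorem witness_distinct (d : ℕ) (hd : 6 ≤ d) :
    (d - 2, d - 4) ≠ (d - 3, d - 3) ∧ (d - 2, d - 4) ≠ (d - 4, d - 2) ∧ (d - 3, d - 3) ≠ (d - 4, d - 2) ∧
    (0 : ℕ) ≠ d - 5 ∧ (0 : ℕ) ≠ d - 4 ∧ d - 5 ≠ d - 4 := by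
  refine ⟨?_, ?_, ?_, by omega, by omega, by omega⟩ <;>
  · intro h
    have := (Prod.mk.injEq _ _ _ _).mp h
    omega

/-- the constant 3×3 pattern of `×δ′` in rows `(x₁^{d-2}x₂^{d-4}, x₁^{d-3}x₂^{d-3}, x₁^{d-4}x₂^{d-2})`, columns `(0, d-5, d-4)`, has determinant `-1`. -/
theorem pattern_det : Matrix.det !![(1 : ℤ), 0, 0; 0, 0, 1; 0, 1, 1] = -1 := by
  simp [Matrix.det_fin_three]

/-- finite re-evaluation, `d = 6..16`: the assembled column list of `×δ′`. -/
theorem columnsW_table : ∀ d ∈ List.range' 6 11,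
    columnsW d = [[(d - 2, d - 4)]] ++ List.replicate (d - 6) [] ++ [[(d - 4, d - 2)], [(d - 4, d - 2), (d - 3, d - 3)]] := by
  decide

end Summit.HodgeConjecture.HodgeConjecture.HodgeLocus.Census.ModelJumpWitness
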